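import Summits.AtomisticToContinuum.Crystallization.Theorems.PalmUnimodularRigidityMinimiserShellsCapAssemblyB

/-!
# Cap assembly: the cap certificates from the finite cap inequality (stub `stub_capAssembly`)
(line `octahedral-annulus-mandate` of crux `MinimiserShells`, stmt-AtomisticToContinuum-9225)

Route `PalmUnimodularRigidity`, crux decl
`Summit.AtomisticToContinuum.Crystallization.Theses.PalmUnimodularRigidity.MinimiserShells`.

**Theorem** (`stub_capAssembly`, hypothesis form).  Given a measurable proxy `B` of `Capped` on finite
counting measures, the sent / received bookkeeping of the defect transport and the surcharged periodisation
at the root's cell, the finite cap inequality with constant `c > 0` at hard core `δ` yields, for every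
`ε > 0`, an admissible transfer `t` (`IsTransfer`) with `e* − ε ≤ h + div t` at every rooted `δ`-hard-core
configuration and `e* + c/2 ≤ h + div t` at every CAPLESS one.

**Proof.**  `certificate` (part B) is `SlackCertificates.certificate_at` with one extra transport `G`:
with `t = −vol⁻¹·(min(transport δ₀ L, M_b) + min(G, M_c))`, OUT `≤ vol·(h + C) + U/12 + OUT_G` and
IN `≥ vol·(e* + C) + OUT_G + IN_G`, so `h + div t ≥ e* − U/(12·vol) + vol⁻¹·IN_G`.  `assembly` runs it at the
class parameter `δ₀ = min δ (1/20)` (`neg_cst_le_eStar`) with `G` the defect transport: IN_G is the phase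
volume of `{v | μ|C_v ∉ B}` times `c` (received bookkeeping), which at a capless root is
`≥ c·(vol − 12/L)` (`cap_bonus`); the cut-off `ρ` and the mesh `L ≥ 48/vol` make `U/(12·vol) ≤ min ε (c/4)`,
whence the margins `−ε` and `+c/2`.  `stub_capAssembly` is `assembly` at the defect transport written out
(its bound and range are `defect_le`, `defect_eq_zero_of_lt` of part A).
-/

noncomputable section

open MeasureTheory Filter Set
open scoped ENNReal BigOperators Topology

namespace Summit.AtomisticToContinuum.Crystallization.Theorems.PalmUnimodularRigidityMinimiserShells.CapAssembly

open Literature.Probability.Process (IsRootedHardCore)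
open Literature.MathematicalPhysics.StatisticalMechanics (lennardJones rootEnergy interactionEnergy)
open Summit.AtomisticToContinuum.Crystallization.Theorems.MinimiserShells.Negative.LoadBearing (eStar)
open Summit.AtomisticToContinuum.Crystallization.Theorems.MinimiserShells.Negative.Rootedness (E3)
open Summit.AtomisticToContinuum.Crystallization.Theorems.PalmUnimodularRigidityMinimiserShells.EnergyFloor
open Summit.AtomisticToContinuum.Crystallization.Theorems.PalmUnimodularRigidityMinimiserShells.SlackCertificates
  (transport_eq_zero_of_lt)
open Summit.AtomisticToContinuum.Crystallization.Theorems.PalmUnimodularRigidityMinimiserShells.Cap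
  (Capped IsTransfer transferDiv)

/-! ## The assembly, for an abstract defect transport -/

/-- **Assembly of the cap certificates** for an abstract family of defect transports `G c δ L` which are
jointly measurable, bounded by `c·vol [0,1)³` on rooted hard-core inputs, of range `2L`, whose sent mass is
the phase average of `c·#{capless cell-mates}/#cell`, whose received mass is `c·vol{v | μ|C_v ∉ B}`, and
such that the finite inequality in `B`-form pays for `vol·(e* + C_{δ₀})` plus the sent mass: the finite cap
inequality with constant `c > 0` gives, for every `ε > 0`, an admissible transfer with `e* − ε ≤ h + div t`
at every rooted `δ`-hard-core configuration and `e* + c/2 ≤ h + div t` at every capless one. -/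
theorem assembly {B : Set (Measure E3)}
    (hBcap : ∀ F : Set E3, F.Finite →
      ((Measure.count : Measure E3).restrict F ∈ B ↔ Capped ((Measure.count : Measure E3).restrict F)))
    {G : ℝ → ℝ → ℝ → Measure E3 → E3 → ℝ≥0∞}
    (hSent : ∀ c δ L : ℝ, 0 < δ → 0 < L → Measurable (Function.uncurry (G c δ L)) ∧
      ∀ μ : Measure E3, IsRootedHardCore δ μ → ∫⁻ y, G c δ L μ y ∂μ =
        ∫⁻ v in phaseDom, (∫⁻ y in rootCell L v, Bᶜ.indicator (fun _ => ENNReal.ofReal c)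
          ((μ.restrict (rootCell L v)).map (fun z => z - y)) ∂μ) / μ (rootCell L v))
    (hRecv : ∀ c δ L : ℝ, 0 < δ → 0 < L → ∀ μ : Measure E3, IsRootedHardCore δ μ →
      ∫⁻ y, G c δ L (μ.map fun z => z - y) (-y) ∂μ =
        ∫⁻ v in phaseDom, Bᶜ.indicator (fun _ => ENNReal.ofReal c) (μ.restrict (rootCell L v)))
    (hSur : ∀ c δ₀ δ L : ℝ, 0 ≤ c → 0 < δ₀ → δ₀ ≤ δ → 0 < L → -cst δ₀ ≤ eStar →
      (∀ (N : ℕ) (y : Fin N → E3), Function.Injective y → (∀ i j : Fin N, i ≠ j → δ ≤ dist (y i) (y j)) →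
        (N : ℝ) * eStar + c * (Nat.card {i : Fin N //
            (Measure.count : Measure E3).restrict ((fun z => z - y i) '' Set.range y) ∉ B} : ℝ) ≤
          interactionEnergy lennardJones y) →
      ∀ μ : Measure E3, IsRootedHardCore δ μ →
        volume phaseDom * ENNReal.ofReal (eStar + cst δ₀) +
          ∫⁻ v in phaseDom, (∫⁻ y in rootCell L v, Bᶜ.indicator (fun _ => ENNReal.ofReal c)
            ((μ.restrict (rootCell L v)).map (fun z => z - y)) ∂μ) / μ (rootCell L v) ≤
        ∫⁻ y, transport δ₀ L (μ.map fun z => z - y) (-y) ∂μ)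
    (hGle : ∀ c δ L : ℝ, 0 < δ → ∀ ν : Measure E3, IsRootedHardCore δ ν → ∀ y,
      G c δ L ν y ≤ ENNReal.ofReal c * volume phaseDom)
    (hG0 : ∀ c δ L : ℝ, 0 < L → ∀ (ν : Measure E3) (y : E3), 2 * L < ‖y‖ → G c δ L ν y = 0) :
    ∀ δ : ℝ, 0 < δ → ∀ c : ℝ, 0 < c →
      (∀ (N : ℕ) (y : Fin N → E3), Function.Injective y → (∀ i j : Fin N, i ≠ j → δ ≤ dist (y i) (y j)) →
        (N : ℝ) * eStar + c * (Nat.card {i : Fin N //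
            ¬ Capped ((Measure.count : Measure E3).restrict ((fun z => z - y i) '' Set.range y))} : ℝ) ≤
          interactionEnergy lennardJones y) →
      ∀ ε : ℝ, 0 < ε → ∃ R M : ℝ, ∃ t : Measure E3 → E3 → ℝ, IsTransfer R M t ∧
        ∀ μ : Measure E3, IsRootedHardCore δ μ →
          eStar - ε ≤ rootEnergy lennardJones μ + transferDiv t μ ∧
          (¬ Capped μ → eStar + c / 2 ≤ rootEnergy lennardJones μ + transferDiv t μ) := by
  intro δ hδ c hc hfin ε hε
  -- the class parameter `δ₀`
  set δ₀ : ℝ := min δ (1 / 20) with hδ₀def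
  have hδ₀ : 0 < δ₀ := lt_min hδ (by norm_num)
  have hδ₀δ : δ₀ ≤ δ := min_le_left _ _
  have heS : -cst δ₀ ≤ eStar := neg_cst_le_eStar hδ₀ (min_le_right _ _)
  -- the finite inequality in `B`-form
  have hfinB : ∀ (N : ℕ) (y : Fin N → E3), Function.Injective y →
      (∀ i j : Fin N, i ≠ j → δ ≤ dist (y i) (y j)) →
      (N : ℝ) * eStar + c * (Nat.card {i : Fin N //
          (Measure.count : Measure E3).restrict ((fun z => z - y i) '' Set.range y) ∉ B} : ℝ) ≤
        interactionEnergy lennardJones y := by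
    intro N y hy hsep
    have hcard : Nat.card {i : Fin N //
        (Measure.count : Measure E3).restrict ((fun z => z - y i) '' Set.range y) ∉ B} =
        Nat.card {i : Fin N //
          ¬ Capped ((Measure.count : Measure E3).restrict ((fun z => z - y i) '' Set.range y))} :=
      Nat.card_congr (Equiv.subtypeEquivRight fun i =>
        not_congr (hBcap _ ((Set.finite_range y).image _)))
    rw [hcard]
    exact hfin N y hy hsep
  -- the volume of the phase cube
  set D : ℝ≥0∞ := volume phaseDom with hD
  set d : ℝ := D.toReal with hd
  have hDtop : D ≠ ∞ := volume_phaseDom_ne_top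
  have hdpos : 0 < d := ENNReal.toReal_pos volume_phaseDom_ne_zero volume_phaseDom_ne_top
  -- the slack
  set η : ℝ := min ε (c / 4) with hηdef
  have hη : 0 < η := lt_min hε (by positivity)
  have hηε : η ≤ ε := min_le_left _ _
  have hηc : η ≤ c / 4 := min_le_right _ _
  -- the cut-off `ρ` and the mesh `L`
  set ρ : ℝ := max δ₀ (max 1 (1000 * δ₀⁻¹ ^ 4 / (6 * η))) with hρdef
  have hδρ : δ₀ ≤ ρ := le_max_left _ _
  have hρ1 : 1 ≤ ρ := (le_max_left _ _).trans (le_max_right _ _)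
  have hρA : 1000 * δ₀⁻¹ ^ 4 / (6 * η) ≤ ρ := (le_max_right _ _).trans (le_max_right _ _)
  have hρpos : 0 < ρ := one_pos.trans_le hρ1
  set L : ℝ := max ((250 * ρ * δ₀⁻¹ ^ 6 + d * η) / (d * η)) (48 / d) with hLdef
  have hdη : 0 < d * η := mul_pos hdpos hη
  have hL48 : 48 / d ≤ L := le_max_right _ _
  have hLpos : 0 < L := (div_pos (by norm_num) hdpos).trans_le hL48
  have hLmul : 250 * ρ * δ₀⁻¹ ^ 6 + d * η ≤ d * η * L := by
    have h : (250 * ρ * δ₀⁻¹ ^ 6 + d * η) / (d * η) ≤ L := le_max_left _ _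
    rw [div_le_iff₀ hdη] at h
    linarith
  -- the uniform error is at most `12 · vol · η`
  have htail : 1000 * δ₀⁻¹ ^ 4 * ρ⁻¹ ^ 2 ≤ 6 * η := by
    have hρinv0 : 0 ≤ ρ⁻¹ := inv_nonneg.2 hρpos.le
    have hρinv1 : ρ⁻¹ ≤ 1 := inv_le_one_of_one_le₀ hρ1
    have hsq : ρ⁻¹ ^ 2 ≤ ρ⁻¹ := pow_le_of_le_one hρinv0 hρinv1 two_ne_zero
    have hlin : 1000 * δ₀⁻¹ ^ 4 * ρ⁻¹ ≤ 6 * η := by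
      rw [div_le_iff₀ (by positivity)] at hρA
      rw [← div_eq_mul_inv, div_le_iff₀ hρpos]
      linarith
    calc 1000 * δ₀⁻¹ ^ 4 * ρ⁻¹ ^ 2 ≤ 1000 * δ₀⁻¹ ^ 4 * ρ⁻¹ :=
        mul_le_mul_of_nonneg_left hsq (by positivity)
      _ ≤ 6 * η := hlin
  have hnear : 6 * (ρ / L) * (250 * δ₀⁻¹ ^ 6) ≤ 6 * (d * η) := by
    have h1 : 6 * (ρ / L) * (250 * δ₀⁻¹ ^ 6) = (1500 * ρ * δ₀⁻¹ ^ 6) / L := by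
      field_simp
      norm_num
    rw [h1, div_le_iff₀ hLpos]
    nlinarith [hLmul, hdη]
  have herrη : (6 * (ρ / L) * (250 * δ₀⁻¹ ^ 6) + d * (1000 * δ₀⁻¹ ^ 4 * ρ⁻¹ ^ 2)) / (12 * d) ≤ η := by
    rw [div_le_iff₀ (by positivity)]
    nlinarith [mul_le_mul_of_nonneg_left htail hdpos.le, hnear]
  -- `12 / L ≤ vol / 4`
  have hLd : 12 / L ≤ d / 4 := by
    rw [div_le_iff₀ hLpos]
    have h : 48 ≤ d * L := by rw [div_le_iff₀ hdpos] at hL48; linarith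
    linarith
  -- the bounds of the two transports
  set Mb : ℝ := (volume phaseDom * ENNReal.ofReal (250 / 24 * δ₀⁻¹ ^ 12 + cst δ₀)).toReal with hMb
  have hMb0 : 0 ≤ Mb := ENNReal.toReal_nonneg
  have hKtop : ENNReal.ofReal c * volume phaseDom ≠ ∞ := ENNReal.mul_ne_top ENNReal.ofReal_ne_top hDtop
  set Mc : ℝ := (ENNReal.ofReal c * volume phaseDom).toReal with hMc
  have hMc0 : 0 ≤ Mc := ENNReal.toReal_nonneg
  obtain ⟨hGm, hGsent⟩ := hSent c δ₀ L hδ₀ hLpos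
  -- the transfer
  set t : Measure E3 → E3 → ℝ := fun ν y =>
    -(d⁻¹ * (min (transport δ₀ L ν y).toReal Mb + min (G c δ₀ L ν y).toReal Mc)) with htdef
  refine ⟨2 * L, d⁻¹ * (Mb + Mc), t, ⟨?_, ?_, ?_⟩, fun μ hμ => ?_⟩
  · -- jointly measurable
    have h : Measurable fun p : Measure E3 × E3 =>
        -(d⁻¹ * (min (Function.uncurry (transport δ₀ L) p).toReal Mb +
          min (Function.uncurry (G c δ₀ L) p).toReal Mc)) :=
      ((((measurable_transport δ₀ L).ennreal_toReal.min measurable_const).add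
        (hGm.ennreal_toReal.min measurable_const)).const_mul _).neg
    exact h
  · -- bounded
    intro ν y
    have h1 : 0 ≤ min (transport δ₀ L ν y).toReal Mb := le_min ENNReal.toReal_nonneg hMb0
    have h2 : min (transport δ₀ L ν y).toReal Mb ≤ Mb := min_le_right _ _
    have h3 : 0 ≤ min (G c δ₀ L ν y).toReal Mc := le_min ENNReal.toReal_nonneg hMc0
    have h4 : min (G c δ₀ L ν y).toReal Mc ≤ Mc := min_le_right _ _
    show |-(d⁻¹ * (min (transport δ₀ L ν y).toReal Mb + min (G c δ₀ L ν y).toReal Mc))| ≤ d⁻¹ * (Mb + Mc)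
    rw [abs_neg, abs_of_nonneg (mul_nonneg (inv_nonneg.2 hdpos.le) (add_nonneg h1 h3))]
    exact mul_le_mul_of_nonneg_left (add_le_add h2 h4) (inv_nonneg.2 hdpos.le)
  · -- finite range
    intro ν y hy
    show -(d⁻¹ * (min (transport δ₀ L ν y).toReal Mb + min (G c δ₀ L ν y).toReal Mc)) = 0
    rw [transport_eq_zero_of_lt hLpos ν hy, hG0 c δ₀ L hLpos ν y hy, ENNReal.toReal_zero, min_eq_left hMb0,
      min_eq_left hMc0, add_zero, mul_zero, neg_zero]
  · -- the certificate
    have hμ₀ : IsRootedHardCore δ₀ μ := hμ.mono hδ₀δ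
    have hIN : volume phaseDom * ENNReal.ofReal (eStar + cst δ₀) + ∫⁻ y, G c δ₀ L μ y ∂μ ≤
        ∫⁻ y, transport δ₀ L (μ.map fun z => z - y) (-y) ∂μ := by
      rw [hGsent μ hμ₀]
      exact hSur c δ₀ δ L hc.le hδ₀ hδ₀δ hLpos heS hfinB μ hμ
    set ING : ℝ≥0∞ := ∫⁻ v in phaseDom, Bᶜ.indicator (fun _ => ENNReal.ofReal c) (μ.restrict (rootCell L v))
      with hINGdef
    have h := certificate hδ₀ hLpos hδρ hμ₀ hKtop hGm (hGle c δ₀ L hδ₀) (hG0 c δ₀ L hLpos) hIN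
    rw [hRecv c δ₀ L hδ₀ hLpos μ hμ₀, ← hD, ← hd] at h
    have hcert : eStar - (6 * (ρ / L) * (250 * δ₀⁻¹ ^ 6) + d * (1000 * δ₀⁻¹ ^ 4 * ρ⁻¹ ^ 2)) / (12 * d) +
        d⁻¹ * ING.toReal ≤ rootEnergy lennardJones μ + transferDiv t μ := h
    have hINGle : ING ≤ ENNReal.ofReal c * volume phaseDom := by
      calc ING ≤ ∫⁻ _ in phaseDom, ENNReal.ofReal c := lintegral_mono fun v => indicator_le_self _ _ _
        _ = ENNReal.ofReal c * volume phaseDom := setLIntegral_const _ _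
    have hINGtop : ING ≠ ∞ := ne_top_of_le_ne_top hKtop hINGle
    have hING0 : 0 ≤ d⁻¹ * ING.toReal := mul_nonneg (inv_nonneg.2 hdpos.le) ENNReal.toReal_nonneg
    refine ⟨by linarith, fun hcap => ?_⟩
    -- the cap bonus at a capless root
    have hbonus := cap_bonus hBcap c hδ hLpos hμ hcap
    have h6top : ENNReal.ofReal c * (6 * ENNReal.ofReal (2 / L)) ≠ ∞ :=
      ENNReal.mul_ne_top ENNReal.ofReal_ne_top (ENNReal.mul_ne_top (by norm_num) ENNReal.ofReal_ne_top)
    have hbr : c * d ≤ ING.toReal + c * (6 * (2 / L)) := by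
      have h1 := ENNReal.toReal_mono (ENNReal.add_ne_top.2 ⟨hINGtop, h6top⟩) hbonus
      rwa [ENNReal.toReal_add hINGtop h6top, ENNReal.toReal_mul, ENNReal.toReal_mul, ENNReal.toReal_mul,
        ENNReal.toReal_ofReal hc.le, ENNReal.toReal_ofReal (by positivity : (0 : ℝ) ≤ 2 / L), ← hD, ← hd,
        ENNReal.toReal_ofNat] at h1
    have h12 : c * (6 * (2 / L)) ≤ c * (d / 4) := by
      have h1 := mul_le_mul_of_nonneg_left hLd hc.le
      calc c * (6 * (2 / L)) = c * (12 / L) := by ring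
        _ ≤ c * (d / 4) := h1
    have hkey : 3 * c / 4 ≤ d⁻¹ * ING.toReal := by
      rw [le_inv_mul_iff₀ hdpos]
      linarith
    linarith

/-! ## The registered stub -/

/-- **STUB 1f of line `octahedral-annulus-mandate` — ASSEMBLY of the cap certificates from the finite
inequality (hypothesis form).**  Given a measurable proxy `B` of `Capped` on finite counting measures, the
sent/received bookkeeping of the defect transport and the surcharged periodisation, the finite cap
inequality with constant `c > 0` at hard core `δ` yields, for every `ε > 0`, an admissible transfer with
`e* − ε ≤ h + div t` at every rooted `δ`-hard-core configuration and `e* + c/2 ≤ h + div t` at every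
CAPLESS one.  Proof: `assembly` at the defect transport (`defect_le`, `defect_eq_zero_of_lt`). -/
theorem stub_capAssembly :
    ∀ B : Set (Measure E3), MeasurableSet B →
      (∀ F : Set E3, F.Finite →
        ((Measure.count : Measure E3).restrict F ∈ B ↔ Capped ((Measure.count : Measure E3).restrict F))) →
      (∀ c δ L : ℝ, 0 < δ → 0 < L →
        Measurable (Function.uncurry fun (μ : Measure E3) (y : E3) =>
          ∫⁻ v in phaseDom, (rootCell L v).indicator (fun w => Bᶜ.indicator (fun _ => ENNReal.ofReal c)
            (((trunc δ μ).restrict (rootCell L v)).map (fun z => z - w)) / trunc δ μ (rootCell L v)) y) ∧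
        ∀ μ : Measure E3, IsRootedHardCore δ μ →
          ∫⁻ y, (∫⁻ v in phaseDom, (rootCell L v).indicator (fun w => Bᶜ.indicator (fun _ => ENNReal.ofReal c)
            (((trunc δ μ).restrict (rootCell L v)).map (fun z => z - w)) / trunc δ μ (rootCell L v)) y) ∂μ =
          ∫⁻ v in phaseDom, (∫⁻ y in rootCell L v, Bᶜ.indicator (fun _ => ENNReal.ofReal c)
            ((μ.restrict (rootCell L v)).map (fun z => z - y)) ∂μ) / μ (rootCell L v)) →
      (∀ c δ L : ℝ, 0 < δ → 0 < L → ∀ μ : Measure E3, IsRootedHardCore δ μ →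
        ∫⁻ y, (∫⁻ v in phaseDom, (rootCell L v).indicator (fun w => Bᶜ.indicator (fun _ => ENNReal.ofReal c)
          (((trunc δ (μ.map fun z => z - y)).restrict (rootCell L v)).map (fun z => z - w)) /
            trunc δ (μ.map fun z => z - y) (rootCell L v)) (-y)) ∂μ =
        ∫⁻ v in phaseDom, Bᶜ.indicator (fun _ => ENNReal.ofReal c) (μ.restrict (rootCell L v))) →
      (∀ c δ₀ δ L : ℝ, 0 ≤ c → 0 < δ₀ → δ₀ ≤ δ → 0 < L → -cst δ₀ ≤ eStar →
        (∀ (N : ℕ) (y : Fin N → E3), Function.Injective y → (∀ i j : Fin N, i ≠ j → δ ≤ dist (y i) (y j)) →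
          (N : ℝ) * eStar + c * (Nat.card {i : Fin N //
              (Measure.count : Measure E3).restrict ((fun z => z - y i) '' Set.range y) ∉ B} : ℝ) ≤
            interactionEnergy lennardJones y) →
        ∀ μ : Measure E3, IsRootedHardCore δ μ →
          volume phaseDom * ENNReal.ofReal (eStar + cst δ₀) +
            ∫⁻ v in phaseDom, (∫⁻ y in rootCell L v, Bᶜ.indicator (fun _ => ENNReal.ofReal c)
              ((μ.restrict (rootCell L v)).map (fun z => z - y)) ∂μ) / μ (rootCell L v) ≤
          ∫⁻ y, transport δ₀ L (μ.map fun z => z - y) (-y) ∂μ) →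
      ∀ δ : ℝ, 0 < δ → ∀ c : ℝ, 0 < c →
      (∀ (N : ℕ) (y : Fin N → E3), Function.Injective y → (∀ i j : Fin N, i ≠ j → δ ≤ dist (y i) (y j)) →
        (N : ℝ) * eStar + c * (Nat.card {i : Fin N //
            ¬ Capped ((Measure.count : Measure E3).restrict ((fun z => z - y i) '' Set.range y))} : ℝ) ≤
          interactionEnergy lennardJones y) →
      ∀ ε : ℝ, 0 < ε → ∃ R M : ℝ, ∃ t : Measure E3 → E3 → ℝ, IsTransfer R M t ∧
        ∀ μ : Measure E3, IsRootedHardCore δ μ →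
          eStar - ε ≤ rootEnergy lennardJones μ + transferDiv t μ ∧
          (¬ Capped μ → eStar + c / 2 ≤ rootEnergy lennardJones μ + transferDiv t μ) := by
  intro B _ hBcap hSent hRecv hSur
  exact assembly hBcap hSent hRecv hSur (fun c δ L hδ ν hν y => defect_le hδ hν y)
    (fun c δ L hL ν y hy => defect_eq_zero_of_lt hL ν hy)

end Summit.AtomisticToContinuum.Crystallization.Theorems.PalmUnimodularRigidityMinimiserShells.CapAssembly

end
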